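import Mathlib

/-!
# Crux `PrimeTwoFamilies` (stmt-MatrixMultiplication-14308), line `Sketch` (capacity form) —
# stub `stub_honestOfSelfConverse`, explicit word-square route

Self-converse gadgets contain honest SDPP designs, by an EXPLICIT construction that uses every letter:
the graph of `π` as a length-two word code, made cyclic by a carry-free embedding.

Given a gadget of direct pairs `(P c, Q c)_{c < r}` in `ℤ/m` and a map `π` such that every ordered pair of
distinct letters `σ ≠ τ` is strongly separated either directly or after `π`, the `r` WORDS `(σ, π σ)` give
the pairs `A σ := P σ × P (π σ)`, `B σ := Q σ × Q (π σ)` in `(ℤ/m)²`: clause (W) holds coordinatewise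
(direct pairs), and clause (X) holds because an off-diagonal coincidence `a + b' = a' + b`
(`a ∈ A σ, b' ∈ B τ, a' ∈ A c, b ∈ B c`) is a cross/diagonal coincidence of differences in the first
coordinate for the letters `(σ, τ)` and in the second coordinate for `(π σ, π τ)` — one of the two is
excluded.  The host `(ℤ/m)²` is then replaced by the cyclic group `ℤ/(4m²)` through the carry-free map
`(x₁, x₂) ↦ val x₁ + 2m · val x₂`, which reflects every four-term relation `a - a' + b - b' = 0`
(all digit sums stay below the radix `2m`, all values below `4m²`), so (W) and (X) transfer verbatim and
cardinalities multiply.  Bookkeeping: with the hypothesis at `ε₀/2`, `ε₀ := min ε (1/4)`, and `m` so large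
that `4 ≤ m^{ε₀}`, one has `4m² ≤ m^{2+ε₀}`, hence `n = r ≥ m^{1-ε₀/2} ≥ (4m²)^{1/2-ε₀}` and
`|A σ||B σ| ≥ m^{2-ε₀} ≥ (4m²)^{1-ε₀}`; finally the exponents are relaxed from `ε₀` to `ε`.

Main results: `wordSquare_honest` (abstract transport through any coordinatewise-reflecting map),
`embed_reflects` (the radix-`2m` map reflects four-term relations), `honest_wordSquare` (finitary,
threshold-free: every self-converse gadget in `ℤ/m` yields an explicit honest family of the same number `r`
of pairs in `ℤ/(4m²)` with multiplied co-volumes), `rpow_bookkeeping`, and the registered stub.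

This is an independent proof of the registered stub (siege best-of-24, variation "explicit / elementary";
the tree's `…Theorems.PrimeTwoFamilies.CapacityLift.stub_honestOfSelfConverse` goes through a popular point
inside the same `ℤ/m` and keeps only the letters through it); it lives in its own namespace
`…Theorems.PrimeTwoFamilies.WordSquare`, so no name collides.  Helper file landed
`--supports stmt-MatrixMultiplication-14308`; the last statement is the registered stub signature verbatim
(gadget / SDPP clauses inlined); no definitions, imports Mathlib only.
-/

-- single-conjunct summit: the mandated namespace repeats `MatrixMultiplication`.
set_option linter.dupNamespace false

namespace Summit.MatrixMultiplication.MatrixMultiplication.Theorems.PrimeTwoFamilies.WordSquare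

open Finset

/-- **Word-square transport** (abstract form).  Let `(P c, Q c)_{c<r}` be direct pairs in an additive
group `G` with the self-converse separation property for `π`, and let `e : G × G → H` reflect four-term
relations coordinatewise (`e a - e a' + e b - e b' = 0` forces `a₁ - a'₁ + b₁ - b'₁ = 0` and
`a₂ - a'₂ + b₂ - b'₂ = 0`).  Then the images `A i := e(P i × P (π i))`, `B i := e(Q i × Q (π i))` satisfy
the SDPP clauses (W) and (X) verbatim. -/
theorem wordSquare_honest {G H : Type*} [AddCommGroup G] [AddCommGroup H] [DecidableEq H] {r : ℕ}
    (P Q : Fin r → Finset G) (π : Fin r → Fin r)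
    (hD : ∀ c : Fin r, ∀ x ∈ P c, ∀ x' ∈ P c, ∀ y ∈ Q c, ∀ y' ∈ Q c,
      (x - x') + (y - y') = 0 → x = x' ∧ y = y')
    (hπ : ∀ σ τ : Fin r, σ ≠ τ →
      (∀ x ∈ P σ, ∀ y ∈ Q τ, ∀ c : Fin r, ∀ x' ∈ P c, ∀ y' ∈ Q c, y - x ≠ y' - x') ∨
      (∀ x ∈ P (π σ), ∀ y ∈ Q (π τ), ∀ c : Fin r, ∀ x' ∈ P c, ∀ y' ∈ Q c, y - x ≠ y' - x'))
    (e : G × G → H)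
    (he : ∀ a a' b b' : G × G, (e a - e a') + (e b - e b') = 0 →
      (a.1 - a'.1) + (b.1 - b'.1) = 0 ∧ (a.2 - a'.2) + (b.2 - b'.2) = 0) :
    (∀ i : Fin r, ∀ a ∈ (P i ×ˢ P (π i)).image e, ∀ a' ∈ (P i ×ˢ P (π i)).image e,
        ∀ b ∈ (Q i ×ˢ Q (π i)).image e, ∀ b' ∈ (Q i ×ˢ Q (π i)).image e,
        (a - a') + (b - b') = 0 → a = a' ∧ b = b') ∧
    (∀ i j k : Fin r, ∀ a ∈ (P i ×ˢ P (π i)).image e, ∀ a' ∈ (P j ×ˢ P (π j)).image e,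
        ∀ b ∈ (Q j ×ˢ Q (π j)).image e, ∀ b' ∈ (Q k ×ˢ Q (π k)).image e,
        (a - a') + (b - b') = 0 → i = k) := by
  constructor
  · intro i a ha a' ha' b hb b' hb' h0
    simp only [Finset.mem_image, Finset.mem_product] at ha ha' hb hb'
    obtain ⟨p, ⟨hp1, hp2⟩, rfl⟩ := ha
    obtain ⟨p', ⟨hp'1, hp'2⟩, rfl⟩ := ha'
    obtain ⟨q, ⟨hq1, hq2⟩, rfl⟩ := hb
    obtain ⟨q', ⟨hq'1, hq'2⟩, rfl⟩ := hb'
    obtain ⟨h1, h2⟩ := he p p' q q' h0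
    obtain ⟨e11, e12⟩ := hD i p.1 hp1 p'.1 hp'1 q.1 hq1 q'.1 hq'1 h1
    obtain ⟨e21, e22⟩ := hD (π i) p.2 hp2 p'.2 hp'2 q.2 hq2 q'.2 hq'2 h2
    have hp : p = p' := Prod.ext e11 e21
    have hq : q = q' := Prod.ext e12 e22
    subst hp hq
    exact ⟨rfl, rfl⟩
  · intro i j k a ha a' ha' b hb b' hb' h0
    simp only [Finset.mem_image, Finset.mem_product] at ha ha' hb hb'
    obtain ⟨p, ⟨hp1, hp2⟩, rfl⟩ := ha
    obtain ⟨p', ⟨hp'1, hp'2⟩, rfl⟩ := ha'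
    obtain ⟨q, ⟨hq1, hq2⟩, rfl⟩ := hb
    obtain ⟨q', ⟨hq'1, hq'2⟩, rfl⟩ := hb'
    obtain ⟨h1, h2⟩ := he p p' q q' h0
    by_contra hik
    have k1 : q'.1 - p.1 = q.1 - p'.1 := by
      have : q'.1 - p.1 = (q.1 - p'.1) - ((p.1 - p'.1) + (q.1 - q'.1)) := by abel
      rw [this, h1, sub_zero]
    have k2 : q'.2 - p.2 = q.2 - p'.2 := by
      have : q'.2 - p.2 = (q.2 - p'.2) - ((p.2 - p'.2) + (q.2 - q'.2)) := by abel
      rw [this, h2, sub_zero]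
    rcases hπ i k hik with hs | hs
    · exact hs p.1 hp1 q'.1 hq'1 j p'.1 hp'1 q.1 hq1 k1
    · exact hs p.2 hp2 q'.2 hq'2 (π j) p'.2 hp'2 q.2 hq2 k2

/-- **Mixed-radix uniqueness**: `A + K·B = A' + K·B'` with digits `A, A' < K` forces `A = A'` and
`B = B'`. -/
theorem radix_unique {K A A' B B' : ℕ} (hA : A < K) (hA' : A' < K)
    (h : A + K * B = A' + K * B') : A = A' ∧ B = B' := by
  have hpos : 0 < K := lt_of_le_of_lt (Nat.zero_le _) hA
  have h1 : (A + K * B) / K = B ∧ (A + K * B) % K = A :=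
    (Nat.div_mod_unique hpos).mpr ⟨rfl, hA⟩
  have h2 : (A' + K * B') / K = B' ∧ (A' + K * B') % K = A' :=
    (Nat.div_mod_unique hpos).mpr ⟨rfl, hA'⟩
  rw [h] at h1
  exact ⟨h1.2.symm.trans h2.2, h1.1.symm.trans h2.1⟩

/-- **Carry-free embedding** `(x₁, x₂) ↦ val x₁ + 2m · val x₂ : (ℤ/m)² → ℤ/M` (`M ≥ 4m²`) reflects
four-term relations coordinatewise: if `e a - e a' + e b - e b' = 0` in `ℤ/M` then
`a₁ - a'₁ + b₁ - b'₁ = 0` and `a₂ - a'₂ + b₂ - b'₂ = 0` in `ℤ/m`.  Indeed `e a + e b = e a' + e b'` is an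
identity of natural numbers below `4m² ≤ M`, whose low digits `val a₁ + val b₁ < 2m` and high digits
`val a₂ + val b₂` in radix `2m` must agree. -/
theorem embed_reflects {m M : ℕ} [NeZero m] (hM : 4 * m ^ 2 ≤ M) (e : ZMod m × ZMod m → ZMod M)
    (he : ∀ p, e p = ((p.1.val + 2 * m * p.2.val : ℕ) : ZMod M)) (a a' b b' : ZMod m × ZMod m)
    (h : (e a - e a') + (e b - e b') = 0) :
    (a.1 - a'.1) + (b.1 - b'.1) = 0 ∧ (a.2 - a'.2) + (b.2 - b'.2) = 0 := by
  -- every value is below `2m²`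
  have hlt : ∀ p : ZMod m × ZMod m, p.1.val + 2 * m * p.2.val < 2 * m ^ 2 := by
    intro p
    have h1 : p.1.val < m := ZMod.val_lt p.1
    have h2 : p.2.val + 1 ≤ m := Nat.lt_iff_add_one_le.mp (ZMod.val_lt p.2)
    have h3 : 2 * m * (p.2.val + 1) ≤ 2 * m * m := Nat.mul_le_mul_left (2 * m) h2
    nlinarith [h1, h3]
  -- the relation as an identity of natural numbers
  have h' : e a + e b = e a' + e b' := by
    have : (e a + e b) - (e a' + e b') = (e a - e a') + (e b - e b') := by abel
    rw [← sub_eq_zero, this, h]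
  rw [he a, he b, he a', he b'] at h'
  have hnat : (a.1.val + 2 * m * a.2.val) + (b.1.val + 2 * m * b.2.val) =
      (a'.1.val + 2 * m * a'.2.val) + (b'.1.val + 2 * m * b'.2.val) := by
    have h'' : (((a.1.val + 2 * m * a.2.val) + (b.1.val + 2 * m * b.2.val) : ℕ) : ZMod M) =
        (((a'.1.val + 2 * m * a'.2.val) + (b'.1.val + 2 * m * b'.2.val) : ℕ) : ZMod M) := by
      push_cast at h' ⊢
      exact h'
    rw [ZMod.natCast_eq_natCast_iff', Nat.mod_eq_of_lt (by linarith [hlt a, hlt b]),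
      Nat.mod_eq_of_lt (by linarith [hlt a', hlt b'])] at h''
    exact h''
  -- compare digits in radix `2m`
  have hdig : (a.1.val + b.1.val) + (2 * m) * (a.2.val + b.2.val) =
      (a'.1.val + b'.1.val) + (2 * m) * (a'.2.val + b'.2.val) := by linarith [hnat]
  have hlow : a.1.val + b.1.val < 2 * m := by
    have := ZMod.val_lt a.1; have := ZMod.val_lt b.1; omega
  have hlow' : a'.1.val + b'.1.val < 2 * m := by
    have := ZMod.val_lt a'.1; have := ZMod.val_lt b'.1; omega
  obtain ⟨e1, e2⟩ := radix_unique hlow hlow' hdig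
  -- back to `ℤ/m`
  have c1 : a.1 + b.1 = a'.1 + b'.1 := by
    have := congrArg (Nat.cast : ℕ → ZMod m) e1
    simpa only [Nat.cast_add, ZMod.natCast_val, ZMod.cast_id', id_eq] using this
  have c2 : a.2 + b.2 = a'.2 + b'.2 := by
    have := congrArg (Nat.cast : ℕ → ZMod m) e2
    simpa only [Nat.cast_add, ZMod.natCast_val, ZMod.cast_id', id_eq] using this
  constructor
  · have : (a.1 - a'.1) + (b.1 - b'.1) = (a.1 + b.1) - (a'.1 + b'.1) := by abel
    rw [this, c1, sub_self]
  · have : (a.2 - a'.2) + (b.2 - b'.2) = (a.2 + b.2) - (a'.2 + b'.2) := by abel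
    rw [this, c2, sub_self]

/-- **Exponent bookkeeping** for the word square: if `4 ≤ m^{ε₀}` with `0 < ε₀ ≤ min ε (1/4)` and
`m ≥ 1`, then the modulus `4m² ≤ m^{2+ε₀}` satisfies `(4m²)^{1/2-ε} ≤ m^{1-ε₀/2}` and
`(4m²)^{1-ε} ≤ m^{1-ε₀/2} · m^{1-ε₀/2}`. -/
theorem rpow_bookkeeping {ε ε₀ m : ℝ} (hε₀ : 0 < ε₀) (hε₀ε : ε₀ ≤ ε) (hε₀q : ε₀ ≤ 1 / 4)
    (hm1 : 1 ≤ m) (h4 : 4 ≤ m ^ ε₀) :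
    (4 * m ^ 2) ^ (1 / 2 - ε) ≤ m ^ (1 - ε₀ / 2) ∧
    (4 * m ^ 2) ^ (1 - ε) ≤ m ^ (1 - ε₀ / 2) * m ^ (1 - ε₀ / 2) := by
  have hm0 : 0 < m := by linarith
  have hM0 : (0 : ℝ) ≤ 4 * m ^ 2 := by positivity
  have hM1 : (1 : ℝ) ≤ 4 * m ^ 2 := by nlinarith
  have hMle : 4 * m ^ 2 ≤ m ^ (2 + ε₀) := by
    rw [Real.rpow_add hm0, Real.rpow_two]
    calc 4 * m ^ 2 ≤ m ^ ε₀ * m ^ 2 := mul_le_mul_of_nonneg_right h4 (sq_nonneg _)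
      _ = m ^ 2 * m ^ ε₀ := mul_comm _ _
  constructor
  · calc (4 * m ^ 2) ^ (1 / 2 - ε) ≤ (4 * m ^ 2) ^ (1 / 2 - ε₀) :=
          Real.rpow_le_rpow_of_exponent_le hM1 (by linarith)
      _ ≤ (m ^ (2 + ε₀)) ^ (1 / 2 - ε₀) := Real.rpow_le_rpow hM0 hMle (by linarith)
      _ = m ^ ((2 + ε₀) * (1 / 2 - ε₀)) := (Real.rpow_mul hm0.le _ _).symm
      _ ≤ m ^ (1 - ε₀ / 2) := Real.rpow_le_rpow_of_exponent_le hm1 (by nlinarith)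
  · calc (4 * m ^ 2) ^ (1 - ε) ≤ (4 * m ^ 2) ^ (1 - ε₀) :=
          Real.rpow_le_rpow_of_exponent_le hM1 (by linarith)
      _ ≤ (m ^ (2 + ε₀)) ^ (1 - ε₀) := Real.rpow_le_rpow hM0 hMle (by linarith)
      _ = m ^ ((2 + ε₀) * (1 - ε₀)) := (Real.rpow_mul hm0.le _ _).symm
      _ ≤ m ^ ((1 - ε₀ / 2) + (1 - ε₀ / 2)) :=
          Real.rpow_le_rpow_of_exponent_le hm1 (by nlinarith)
      _ = m ^ (1 - ε₀ / 2) * m ^ (1 - ε₀ / 2) := Real.rpow_add hm0 _ _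

/-- **Explicit honest family from a self-converse gadget** (finitary, threshold-free form of the
stub): for ANY gadget of direct pairs `(P c, Q c)_{c<r}` in `ℤ/m` (`m ≥ 1`) with the self-converse
separation property for `π`, the `r` word-square pairs `A i := e(P i × P (π i))`,
`B i := e(Q i × Q (π i))` in the cyclic group `ℤ/(4m²)` (`e (x₁, x₂) := val x₁ + 2m · val x₂`) form an
honest SDPP family ((W) ∧ (X) verbatim) with exactly `r` pairs and co-volumes
`|A i||B i| = |P i||Q i| · |P (π i)||Q (π i)|` — every letter is used, nothing is discarded. -/
theorem honest_wordSquare {m : ℕ} [NeZero m] {r : ℕ} (P Q : Fin r → Finset (ZMod m))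
    (π : Fin r → Fin r)
    (hD : ∀ c : Fin r, ∀ x ∈ P c, ∀ x' ∈ P c, ∀ y ∈ Q c, ∀ y' ∈ Q c,
      (x - x') + (y - y') = 0 → x = x' ∧ y = y')
    (hπ : ∀ σ τ : Fin r, σ ≠ τ →
      (∀ x ∈ P σ, ∀ y ∈ Q τ, ∀ c : Fin r, ∀ x' ∈ P c, ∀ y' ∈ Q c, y - x ≠ y' - x') ∨
      (∀ x ∈ P (π σ), ∀ y ∈ Q (π τ), ∀ c : Fin r, ∀ x' ∈ P c, ∀ y' ∈ Q c, y - x ≠ y' - x')) :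
    ∃ A B : Fin r → Finset (ZMod (4 * m ^ 2)),
      (∀ i : Fin r, ∀ a ∈ A i, ∀ a' ∈ A i, ∀ b ∈ B i, ∀ b' ∈ B i,
          (a - a') + (b - b') = 0 → a = a' ∧ b = b') ∧
      (∀ i j k : Fin r, ∀ a ∈ A i, ∀ a' ∈ A j, ∀ b ∈ B j, ∀ b' ∈ B k,
          (a - a') + (b - b') = 0 → i = k) ∧
      ∀ i : Fin r, (A i).card * (B i).card =
        ((P i).card * (Q i).card) * ((P (π i)).card * (Q (π i)).card) := by
  -- the carry-free embedding, opaque up to its defining equation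
  obtain ⟨e, he⟩ : ∃ e : ZMod m × ZMod m → ZMod (4 * m ^ 2),
      ∀ p, e p = ((p.1.val + 2 * m * p.2.val : ℕ) : ZMod (4 * m ^ 2)) := ⟨_, fun p => rfl⟩
  have hrefl : ∀ a a' b b' : ZMod m × ZMod m, (e a - e a') + (e b - e b') = 0 →
      (a.1 - a'.1) + (b.1 - b'.1) = 0 ∧ (a.2 - a'.2) + (b.2 - b'.2) = 0 :=
    embed_reflects le_rfl e he
  have hinj : Function.Injective e := by
    intro a a' hab
    obtain ⟨h1, h2⟩ := hrefl a a' a a (by rw [hab, sub_self, add_zero])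
    rw [sub_self, add_zero, sub_eq_zero] at h1 h2
    exact Prod.ext h1 h2
  obtain ⟨hW, hX⟩ := wordSquare_honest P Q π hD hπ e hrefl
  refine ⟨fun i => (P i ×ˢ P (π i)).image e, fun i => (Q i ×ˢ Q (π i)).image e, hW, hX,
    fun i => ?_⟩
  show ((P i ×ˢ P (π i)).image e).card * ((Q i ×ˢ Q (π i)).image e).card = _
  rw [Finset.card_image_of_injective _ hinj, Finset.card_image_of_injective _ hinj,
    Finset.card_product, Finset.card_product]
  ring

/-- **Self-converse gadgets contain honest designs** (registered stub `stub_honestOfSelfConverse` of line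
`Sketch`, crux stmt-MatrixMultiplication-14308), explicit word-square proof: if for every `ε > 0` there are
arbitrarily large `m`, a gadget of `r ≥ m^{1-ε}` direct pairs `(P c, Q c)` in `ℤ/m` of co-volume
`|P c||Q c| ≥ m^{1-ε}`, and a map `π` under which every ordered pair of distinct letters is strongly
separated directly or after `π`, then for every `ε > 0` there are arbitrarily large moduli and an HONEST
SDPP family ((W) ∧ (X) verbatim) with `n ≥ modulus^{1/2-ε}` pairs of co-volume `≥ modulus^{1-ε}`.
Proof: take the hypothesis at `ε₀/2` (`ε₀ := min ε (1/4)`) and `m ≥ max m₀ 1` with `4 ≤ m^{ε₀}`, apply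
`honest_wordSquare` (modulus `4m²`, all `r` letters), and read off
`n = r ≥ m^{1-ε₀/2} ≥ (4m²)^{1/2-ε}` and `|A i||B i| ≥ m^{1-ε₀/2} · m^{1-ε₀/2} ≥ (4m²)^{1-ε}` from
`rpow_bookkeeping`. -/
theorem stub_honestOfSelfConverse
    (h : ∀ ε : ℝ, 0 < ε → ∀ m₀ : ℕ, ∃ m ≥ m₀, ∃ r : ℕ, ∃ P Q : Fin r → Finset (ZMod m),
      ∃ π : Fin r → Fin r,
        (∀ c : Fin r, ∀ x ∈ P c, ∀ x' ∈ P c, ∀ y ∈ Q c, ∀ y' ∈ Q c,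
            (x - x') + (y - y') = 0 → x = x' ∧ y = y') ∧
        (∀ σ τ : Fin r, σ ≠ τ →
            (∀ x ∈ P σ, ∀ y ∈ Q τ, ∀ c : Fin r, ∀ x' ∈ P c, ∀ y' ∈ Q c, y - x ≠ y' - x') ∨
            (∀ x ∈ P (π σ), ∀ y ∈ Q (π τ), ∀ c : Fin r, ∀ x' ∈ P c, ∀ y' ∈ Q c, y - x ≠ y' - x')) ∧
        (m : ℝ) ^ (1 - ε) ≤ (r : ℝ) ∧
        ∀ c : Fin r, (m : ℝ) ^ (1 - ε) ≤ (((P c).card * (Q c).card : ℕ) : ℝ)) :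
    ∀ ε : ℝ, 0 < ε → ∀ m₀ : ℕ, ∃ m ≥ m₀, ∃ n : ℕ, ∃ A B : Fin n → Finset (ZMod m),
      (∀ i : Fin n, ∀ a ∈ A i, ∀ a' ∈ A i, ∀ b ∈ B i, ∀ b' ∈ B i,
          (a - a') + (b - b') = 0 → a = a' ∧ b = b') ∧
      (∀ i j k : Fin n, ∀ a ∈ A i, ∀ a' ∈ A j, ∀ b ∈ B j, ∀ b' ∈ B k,
          (a - a') + (b - b') = 0 → i = k) ∧
      (m : ℝ) ^ (1 / 2 - ε) ≤ (n : ℝ) ∧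
      ∀ i : Fin n, (m : ℝ) ^ (1 - ε) ≤ (((A i).card * (B i).card : ℕ) : ℝ) := by
  intro ε hε m₀
  -- a working exponent `ε₀ ≤ min ε (1/4)`
  obtain ⟨ε₀, hε₀, hε₀ε, hε₀q⟩ : ∃ ε₀ : ℝ, 0 < ε₀ ∧ ε₀ ≤ ε ∧ ε₀ ≤ 1 / 4 :=
    ⟨min ε (1 / 4), lt_min hε (by norm_num), min_le_left _ _, min_le_right _ _⟩
  -- threshold: `4 ≤ m ^ ε₀` for all large `m`
  obtain ⟨N, hN⟩ : ∃ N : ℕ, ∀ m ≥ N, (4 : ℝ) ≤ (m : ℝ) ^ ε₀ := by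
    have ht : Filter.Tendsto (fun m : ℕ => (m : ℝ) ^ ε₀) Filter.atTop Filter.atTop :=
      (tendsto_rpow_atTop hε₀).comp tendsto_natCast_atTop_atTop
    exact Filter.eventually_atTop.1 (ht.eventually_ge_atTop 4)
  -- the gadget at `ε₀ / 2`, made honest by the word square in `ℤ/(4m²)`
  obtain ⟨m, hm, r, P, Q, π, hD, hπ, hr, hcov⟩ := h (ε₀ / 2) (half_pos hε₀) (max (max m₀ 1) N)
  have hm₀ : m₀ ≤ m := le_trans (le_trans (le_max_left _ _) (le_max_left _ _)) hm
  have hm1 : 1 ≤ m := le_trans (le_trans (le_max_right _ _) (le_max_left _ _)) hm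
  have hmN : N ≤ m := le_trans (le_max_right _ _) hm
  haveI : NeZero m := ⟨Nat.one_le_iff_ne_zero.mp hm1⟩
  obtain ⟨A, B, hW, hX, hAB⟩ := honest_wordSquare P Q π hD hπ
  -- bookkeeping
  have hm0 : (0 : ℝ) < m := by exact_mod_cast hm1
  have hm1R : (1 : ℝ) ≤ m := by exact_mod_cast hm1
  obtain ⟨hbk1, hbk2⟩ := rpow_bookkeeping hε₀ hε₀ε hε₀q hm1R (hN m hmN)
  have hmM : m ≤ 4 * m ^ 2 := by
    rw [pow_two]
    exact (Nat.le_mul_self m).trans (Nat.le_mul_of_pos_left _ (by norm_num))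
  have hMR : ((4 * m ^ 2 : ℕ) : ℝ) = 4 * (m : ℝ) ^ 2 := by
    simp only [Nat.cast_mul, Nat.cast_pow, Nat.cast_ofNat]
  refine ⟨4 * m ^ 2, hm₀.trans hmM, r, A, B, hW, hX, ?_, fun i => ?_⟩
  · rw [hMR]
    exact hbk1.trans hr
  · rw [hMR, hAB i]
    refine hbk2.trans ?_
    calc (m : ℝ) ^ (1 - ε₀ / 2) * (m : ℝ) ^ (1 - ε₀ / 2)
        ≤ (((P i).card * (Q i).card : ℕ) : ℝ) * (((P (π i)).card * (Q (π i)).card : ℕ) : ℝ) :=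
          mul_le_mul (hcov i) (hcov (π i)) (Real.rpow_nonneg hm0.le _) (Nat.cast_nonneg _)
      _ = _ := by push_cast; ring

end Summit.MatrixMultiplication.MatrixMultiplication.Theorems.PrimeTwoFamilies.WordSquare
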